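import Summits.CriticalPhenomena.PercolationContinuityZ3.Theorems.PercNearOneGluingNoHeavyLowerTailSahiE3SlotCertificate
import Summits.CriticalPhenomena.PercolationContinuityZ3.Theorems.PercNearOneGluingNoHeavyLowerTailSahiE3CovHit
import Literature.Probability.LatticeModels.SahiThirdOrderCorrelation
import Mathlib.Combinatorics.SetFamily.FourFunctions
import Mathlib.Data.Fintype.Pi
import Mathlib.Order.Irreducible
import Mathlib.Tactic.Linarith
import Mathlib.Tactic.Ring
import Mathlib.Tactic.Positivity
import HarnessLib
import HarnessLib.Audit

/-!
# `NoHeavyLowerTail` (crux stmt-CriticalPhenomena-4575), Sahi programme P4 (Holley / monotone coupling):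
# FKG slot-locality at `k` join-primes — the lattice bookkeeping: Sahi's `C₃` for `(↑j₁ ∪ … ∪ ↑j_k, A, B)`
# from a ρ-certificate on the pattern measure

Support file (cell `prim-l12`, seat P4, generation 7; `--supports stmt-CriticalPhenomena-4575`).  No named facts, no sorries;
standard axioms; def-free (the fibre family of the pattern map is passed as a hypothesis `hF`, as in `…SahiE3TwoPrimeSlot`).

## What is proved

Let `L` be a finite distributive lattice, `μ ≥ 0` log-supermodular (zeros allowed, not normalised, `Z = m(L)`), `A, B ⊆ L` up-sets
and `j : ι → L` a finite family of join-prime elements; `U = {x | ∃ i, j i ≤ x} = ↑j₁ ∪ … ∪ ↑j_k` (a "hitting set").  The pattern map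
`x ↦ (j i ≤ x)_i ∈ (ι → Bool)` is a lattice homomorphism (join-primality); its fibres `F_t` are sublattices and `U = ⋃_{t ≠ ⊥} F_t`.
Write `ν_t = m(F_t)` for the pattern measure.

* `latticeE3_nonneg_of_certificate`: if the pattern measure `ν` admits a certificate `T : (ι → Bool) → ℝ` with
  (T0) `0 ≤ T_t`, (T1) `T_t ≤ Z ν_t (Z + ν_⊥)`, (TΣ) `Σ_{t ≠ ⊥} T_t = Z ν_⊥ m(U)`, (Ti) `Σ_{t ∈ S} T_t ≤ Z ν_⊥ ν(S)` and
  (Tii) `Σ_{t ∈ S ∩ S'} T_t ≤ (Z + ν_⊥)(Z ν(S ∩ S') − ν(S) ν(S'))` for all up-sets `S, S' ∌ ⊥` of the pattern, then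
  `0 ≤ latticeE3 μ U A B` (Sahi's `Z³·E₃(1_U, 1_A, 1_B) ≥ 0`).

This is the general-`k` form of steps (1)–(3) of the two-prime theorem `…SahiE3TwoPrimeSlot` (there the certificate for the
pattern `2²` is written down explicitly).  The lattice side is discharged here once and for all: ONE Ahlswede–Daykin inequality
across fibres (`fib_ad`) gives monotone fibre densities (with phantom values `max_{s ≤ t}` on null fibres) and Harris inside each
fibre, which are exactly the data hypotheses of the pattern theorem `SahiE3SlotCertificate.phi_nonneg_of_certificate`.  What is
left for Sahi's `C₃` on every hitting-set slot under every FKG measure is the existence of `T` for every FKG pattern measure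
(HOME prim-l12-p4/RHO-LEMMA-gen6.md; numerically a certificate always exists on `2³, 2⁴, 2⁵` — e.g. every max-rank-height
capped upward transport of `ν|_{U}` — but this is not proved); the companion file `…SahiE3HitSlotAttribution` constructs `T`
under an explicit "attribution" condition that holds for all product measures.
-/

namespace Summit.CriticalPhenomena.PercolationContinuityZ3.Theorems.SahiE3HitSlotCertificate

open Finset Literature.Probability.LatticeModels
open scoped BigOperators

variable {α : Type*} [DistribLattice α] [Fintype α] [DecidableEq α]
variable {ι : Type*} [Fintype ι] [DecidableEq ι]

/-! ### Fibres of the pattern map `x ↦ (j i ≤ x)_i` -/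

omit [Fintype α] [DecidableEq α] [Fintype ι] [DecidableEq ι] in
/-- Meets of fibre points: `F_s ⊓ F_t ⊆ F_{s ⊓ t}`. [this work] -/
theorem inf_mem_fib {j : ι → α} {F : (ι → Bool) → Finset α}
    (hF : ∀ (t : ι → Bool) (x : α), x ∈ F t ↔ ∀ i, (j i ≤ x ↔ t i = true))
    {x y : α} {s t : ι → Bool} (hx : x ∈ F s) (hy : y ∈ F t) : x ⊓ y ∈ F (s ⊓ t) := by
  rw [hF] at hx hy ⊢
  intro i
  rw [le_inf_iff, hx i, hy i]
  show s i = true ∧ t i = true ↔ (s i && t i) = true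
  rw [Bool.and_eq_true]

omit [Fintype α] [DecidableEq α] [Fintype ι] [DecidableEq ι] in
/-- Joins of fibre points (join-primality): `F_s ⊔ F_t ⊆ F_{s ⊔ t}`. [this work] -/
theorem sup_mem_fib {j : ι → α} (hj : ∀ i, SupPrime (j i)) {F : (ι → Bool) → Finset α}
    (hF : ∀ (t : ι → Bool) (x : α), x ∈ F t ↔ ∀ i, (j i ≤ x ↔ t i = true))
    {x y : α} {s t : ι → Bool} (hx : x ∈ F s) (hy : y ∈ F t) : x ⊔ y ∈ F (s ⊔ t) := by
  rw [hF] at hx hy ⊢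
  intro i
  rw [(hj i).le_sup, hx i, hy i]
  show s i = true ∨ t i = true ↔ (s i || t i) = true
  rw [Bool.or_eq_true]

omit [Fintype ι] [DecidableEq ι] in
/-- **The one Ahlswede–Daykin inequality that is used**: for up-sets `X, Y` and fibres `F_s`, `F_t`,
`m(X ∩ F_s)·m(Y ∩ F_t) ≤ m(F_{s ⊓ t})·m(X ∩ Y ∩ F_{s ⊔ t})`. [this work] -/
theorem fib_ad {μ : α → ℝ} (hμ₀ : 0 ≤ μ) (hμ : ∀ a b, μ a * μ b ≤ μ (a ⊓ b) * μ (a ⊔ b)) {j : ι → α}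
    (hj : ∀ i, SupPrime (j i)) {F : (ι → Bool) → Finset α}
    (hF : ∀ (t : ι → Bool) (x : α), x ∈ F t ↔ ∀ i, (j i ≤ x ↔ t i = true))
    {X Y : Finset α} (hX : IsUpperSet (X : Set α)) (hY : IsUpperSet (Y : Set α)) (s t : ι → Bool) :
    mass μ (X ∩ F s) * mass μ (Y ∩ F t) ≤ mass μ (F (s ⊓ t)) * mass μ (X ∩ Y ∩ F (s ⊔ t)) := by
  refine SahiE3CovHit.mass_mul_mass_le' hμ₀ hμ fun x hx y hy => ?_
  rw [Finset.mem_inter] at hx hy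
  refine ⟨inf_mem_fib hF hx.2 hy.2, ?_⟩
  rw [Finset.mem_inter, Finset.mem_inter]
  exact ⟨⟨hX (show x ≤ x ⊔ y from le_sup_left) hx.1, hY (show y ≤ x ⊔ y from le_sup_right) hy.1⟩,
    sup_mem_fib hj hF hx.2 hy.2⟩

/-! ### Masses split along the fibres -/

section Split

variable [DecidableLE α]

omit [Fintype α] [DecidableEq ι] in
/-- `S ∩ F_t` is the fibre of `t` under the pattern map restricted to `S`. [this work] -/
theorem inter_fib_eq_filter {j : ι → α} {F : (ι → Bool) → Finset α}
    (hF : ∀ (t : ι → Bool) (x : α), x ∈ F t ↔ ∀ i, (j i ≤ x ↔ t i = true)) (S : Finset α) (t : ι → Bool) :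
    S ∩ F t = S.filter fun x => (fun i => decide (j i ≤ x)) = t := by
  ext x
  rw [Finset.mem_inter, Finset.mem_filter, hF]
  simp only [funext_iff, and_congr_right_iff]
  intro _
  refine forall_congr' fun i => ?_
  cases t i <;> simp

omit [Fintype α] [DecidableEq ι] in
/-- `m(S) = Σ_t m(S ∩ F_t)`. [this work] -/
theorem mass_eq_sum_fib [DecidableEq ι] (μ : α → ℝ) {j : ι → α} {F : (ι → Bool) → Finset α}
    (hF : ∀ (t : ι → Bool) (x : α), x ∈ F t ↔ ∀ i, (j i ≤ x ↔ t i = true)) (S : Finset α) :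
    mass μ S = ∑ t, mass μ (S ∩ F t) := by
  unfold mass
  rw [← Finset.sum_fiberwise S (fun x => fun i => decide (j i ≤ x)) μ]
  refine Finset.sum_congr rfl fun t _ => ?_
  rw [inter_fib_eq_filter hF]

omit [DecidableEq ι] in
/-- `m(U ∩ S) = Σ_{t ≠ ⊥} m(S ∩ F_t)` for the hitting set `U = {x | ∃ i, j i ≤ x}`. [this work] -/
theorem mass_hit_inter_eq [DecidableEq ι] (μ : α → ℝ) {j : ι → α} {F : (ι → Bool) → Finset α}
    (hF : ∀ (t : ι → Bool) (x : α), x ∈ F t ↔ ∀ i, (j i ≤ x ↔ t i = true)) (S : Finset α) :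
    mass μ ((univ.filter fun x => ∃ i, j i ≤ x) ∩ S) = ∑ t ∈ univ.erase ⊥, mass μ (S ∩ F t) := by
  rw [mass_eq_sum_fib μ hF, ← Finset.sum_erase_add _ _ (Finset.mem_univ (⊥ : ι → Bool))]
  have e0 : (univ.filter fun x => ∃ i, j i ≤ x) ∩ S ∩ F ⊥ = ∅ := by
    ext x
    simp only [Finset.mem_inter, Finset.mem_filter, Finset.mem_univ, true_and, Finset.notMem_empty, iff_false, not_and,
      hF]
    rintro ⟨⟨i, hi⟩, -⟩ h
    have := (h i).1 hi
    exact Bool.false_ne_true this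
  have e1 : ∀ t ∈ univ.erase (⊥ : ι → Bool), (univ.filter fun x => ∃ i, j i ≤ x) ∩ S ∩ F t = S ∩ F t := by
    intro t ht
    have ht' : t ≠ ⊥ := Finset.ne_of_mem_erase ht
    ext x
    simp only [Finset.mem_inter, Finset.mem_filter, Finset.mem_univ, true_and]
    constructor
    · rintro ⟨⟨-, h1⟩, h2⟩; exact ⟨h1, h2⟩
    · rintro ⟨h1, h2⟩
      refine ⟨⟨?_, h1⟩, h2⟩
      have hx := (hF t x).1 h2
      by_contra hne
      apply ht'
      funext i
      cases hti : t i
      · rfl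
      · exact absurd ⟨i, (hx i).2 hti⟩ hne
  rw [e0, Finset.sum_congr rfl fun t ht => by rw [e1 t ht]]
  unfold mass
  simp

end Split

/-! ### Fibre densities with phantom values on null fibres -/

section Dens

open scoped Classical

variable [DecidableLE α] {μ : α → ℝ}

omit [Fintype ι] [DecidableEq ι] [DecidableLE α] in
/-- Across comparable fibres the `X`-density increases: `m(X ∩ F_s)·m(F_t) ≤ m(F_s)·m(X ∩ F_t)` for `s ≤ t` (`fib_ad` with
`Y = univ`). [this work] -/
theorem dens_cross_le (hμ₀ : 0 ≤ μ) (hμ : ∀ a b, μ a * μ b ≤ μ (a ⊓ b) * μ (a ⊔ b)) {j : ι → α}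
    (hj : ∀ i, SupPrime (j i)) {F : (ι → Bool) → Finset α}
    (hF : ∀ (t : ι → Bool) (x : α), x ∈ F t ↔ ∀ i, (j i ≤ x ↔ t i = true))
    {X : Finset α} (hX : IsUpperSet (X : Set α)) {s t : ι → Bool} (hst : s ≤ t) :
    mass μ (X ∩ F s) * mass μ (F t) ≤ mass μ (F s) * mass μ (X ∩ F t) := by
  have h := fib_ad hμ₀ hμ hj hF hX (show IsUpperSet ((univ : Finset α) : Set α) by
    rw [Finset.coe_univ]; exact isUpperSet_univ) s t
  rwa [Finset.univ_inter, inf_eq_left.2 hst, sup_eq_right.2 hst, Finset.inter_univ] at h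

omit [DistribLattice α] [Fintype α] [DecidableEq α] [DecidableLE α] in
/-- The phantom density `max_{s ≤ t} m(X ∩ F_s)/m(F_s)` is monotone in `t`. [this work] -/
theorem env_mono [DecidableEq α] (μ : α → ℝ) (F : (ι → Bool) → Finset α) (X : Finset α) :
    Monotone fun t : ι → Bool =>
      (univ.filter fun s => s ≤ t).sup' ⟨t, by simp⟩ fun s => mass μ (X ∩ F s) / mass μ (F s) := by
  intro t t' htt'
  refine Finset.sup'_mono (fun s => mass μ (X ∩ F s) / mass μ (F s)) (fun s hs => ?_) _
  rw [Finset.mem_filter] at hs ⊢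
  exact ⟨hs.1, le_trans hs.2 htt'⟩

omit [DistribLattice α] [Fintype α] [DecidableEq α] [DecidableLE α] in
/-- The phantom density is nonnegative. [this work] -/
theorem env_nonneg [DecidableEq α] (hμ₀ : 0 ≤ μ) (F : (ι → Bool) → Finset α) (X : Finset α) (t : ι → Bool) :
    0 ≤ (univ.filter fun s => s ≤ t).sup' ⟨t, by simp⟩ fun s => mass μ (X ∩ F s) / mass μ (F s) :=
  le_trans (div_nonneg (mass_nonneg hμ₀ (X ∩ F t)) (mass_nonneg hμ₀ (F t)))
    (Finset.le_sup' (fun s => mass μ (X ∩ F s) / mass μ (F s)) (by simp : t ∈ univ.filter fun s => s ≤ t))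

omit [DecidableLE α] in
/-- On a fibre of positive mass the phantom density is the true density `m(X ∩ F_t)/m(F_t)` (up-set `X`). [this work] -/
theorem env_eq_dens (hμ₀ : 0 ≤ μ) (hμ : ∀ a b, μ a * μ b ≤ μ (a ⊓ b) * μ (a ⊔ b)) {j : ι → α}
    (hj : ∀ i, SupPrime (j i)) {F : (ι → Bool) → Finset α}
    (hF : ∀ (t : ι → Bool) (x : α), x ∈ F t ↔ ∀ i, (j i ≤ x ↔ t i = true))
    {X : Finset α} (hX : IsUpperSet (X : Set α)) {t : ι → Bool} (ht : 0 < mass μ (F t)) :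
    ((univ.filter fun s => s ≤ t).sup' ⟨t, by simp⟩ fun s => mass μ (X ∩ F s) / mass μ (F s)) =
      mass μ (X ∩ F t) / mass μ (F t) := by
  refine le_antisymm (Finset.sup'_le _ _ fun s hs => ?_)
    (Finset.le_sup' (fun s => mass μ (X ∩ F s) / mass μ (F s)) (by simp : t ∈ univ.filter fun s => s ≤ t))
  rw [Finset.mem_filter] at hs
  have hcross := dens_cross_le hμ₀ hμ hj hF hX hs.2
  rcases (mass_nonneg hμ₀ (F s)).eq_or_lt with h0 | hpos
  · rw [← h0, div_zero]; exact div_nonneg (mass_nonneg hμ₀ _) (mass_nonneg hμ₀ _)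
  · rw [div_le_iff₀ hpos, div_mul_eq_mul_div, le_div_iff₀ ht]
    linarith

omit [DecidableLE α] in
/-- `ν_t · (phantom density) = m(X ∩ F_t)` on every fibre (up-set `X`). [this work] -/
theorem mass_mul_env (hμ₀ : 0 ≤ μ) (hμ : ∀ a b, μ a * μ b ≤ μ (a ⊓ b) * μ (a ⊔ b)) {j : ι → α}
    (hj : ∀ i, SupPrime (j i)) {F : (ι → Bool) → Finset α}
    (hF : ∀ (t : ι → Bool) (x : α), x ∈ F t ↔ ∀ i, (j i ≤ x ↔ t i = true))
    {X : Finset α} (hX : IsUpperSet (X : Set α)) (t : ι → Bool) :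
    mass μ (F t) * ((univ.filter fun s => s ≤ t).sup' ⟨t, by simp⟩ fun s => mass μ (X ∩ F s) / mass μ (F s)) =
      mass μ (X ∩ F t) := by
  rcases (mass_nonneg hμ₀ (F t)).eq_or_lt with h0 | hpos
  · have hXt : mass μ (X ∩ F t) = 0 :=
      le_antisymm (le_trans (mass_mono hμ₀ Finset.inter_subset_right) h0.symm.le) (mass_nonneg hμ₀ _)
    rw [← h0, hXt, zero_mul]
  · rw [env_eq_dens hμ₀ hμ hj hF hX hpos, mul_div_cancel₀ _ hpos.ne']

omit [Fintype ι] [DecidableEq ι] [DecidableLE α] in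
/-- Harris inside a fibre, density form: on a positive fibre `dens_A · dens_B ≤ dens_{A∩B}`. [this work] -/
theorem dens_mul_dens_le (hμ₀ : 0 ≤ μ) (hμ : ∀ a b, μ a * μ b ≤ μ (a ⊓ b) * μ (a ⊔ b)) {j : ι → α}
    (hj : ∀ i, SupPrime (j i)) {F : (ι → Bool) → Finset α}
    (hF : ∀ (t : ι → Bool) (x : α), x ∈ F t ↔ ∀ i, (j i ≤ x ↔ t i = true))
    {A B : Finset α} (hA : IsUpperSet (A : Set α)) (hB : IsUpperSet (B : Set α)) {t : ι → Bool}
    (ht : 0 < mass μ (F t)) :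
    mass μ (A ∩ F t) / mass μ (F t) * (mass μ (B ∩ F t) / mass μ (F t)) ≤ mass μ (A ∩ B ∩ F t) / mass μ (F t) := by
  have h := fib_ad hμ₀ hμ hj hF hA hB t t
  rw [inf_idem, sup_idem] at h
  rw [div_mul_div_comm, div_le_iff₀ (mul_pos ht ht), div_mul_eq_mul_div, le_div_iff₀ ht]
  nlinarith [mass_nonneg hμ₀ (F t)]

end Dens

/-! ### The theorem -/

open scoped Classical in
/-- **FKG slot-locality at `k` join-primes, from a ρ-certificate on the pattern measure.**  `μ ≥ 0` log-supermodular on a finite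
distributive lattice, `j : ι → α` join-primes with pattern fibres `F_t = {x | ∀ i, j i ≤ x ↔ t i}`, `ν_t = m(F_t)`, `A, B` up-sets.
If `T` satisfies (T0), (T1), (TΣ), (Ti), (Tii) of `SahiE3SlotCertificate.phi_nonneg_of_certificate` for `ν` (with
`Σ_{t≠⊥} ν_t = m(U)`), then `0 ≤ latticeE3 μ U A B` for the hitting set `U = {x | ∃ i, j i ≤ x}`. [this work] -/
theorem latticeE3_nonneg_of_certificate [DecidableLE α] {μ : α → ℝ} (hμ₀ : 0 ≤ μ)
    (hμ : ∀ a b, μ a * μ b ≤ μ (a ⊓ b) * μ (a ⊔ b)) {j : ι → α} (hj : ∀ i, SupPrime (j i))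
    {F : (ι → Bool) → Finset α} (hF : ∀ (t : ι → Bool) (x : α), x ∈ F t ↔ ∀ i, (j i ≤ x ↔ t i = true))
    {A B : Finset α} (hA : IsUpperSet (A : Set α)) (hB : IsUpperSet (B : Set α))
    (ν : (ι → Bool) → ℝ) (hν : ∀ t, ν t = mass μ (F t)) (T : (ι → Bool) → ℝ)
    (hT0 : ∀ t, t ≠ ⊥ → 0 ≤ T t) (hT1 : ∀ t, t ≠ ⊥ → T t ≤ (∑ s, ν s) * ν t * ((∑ s, ν s) + ν ⊥))
    (hTsum : ∑ t ∈ univ.erase ⊥, T t = (∑ s, ν s) * ν ⊥ * ∑ t ∈ univ.erase ⊥, ν t)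
    (hTi : ∀ S : Finset (ι → Bool), IsUpperSet (S : Set (ι → Bool)) → ⊥ ∉ S →
      ∑ t ∈ S, T t ≤ (∑ s, ν s) * ν ⊥ * ∑ t ∈ S, ν t)
    (hTii : ∀ S S' : Finset (ι → Bool), IsUpperSet (S : Set (ι → Bool)) → IsUpperSet (S' : Set (ι → Bool)) →
      ⊥ ∉ S → ⊥ ∉ S' →
      ∑ t ∈ S ∩ S', T t ≤ ((∑ s, ν s) + ν ⊥) * ((∑ s, ν s) * ∑ t ∈ S ∩ S', ν t - (∑ t ∈ S, ν t) * ∑ t ∈ S', ν t)) :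
    0 ≤ latticeE3 μ (univ.filter fun x => ∃ i, j i ≤ x) A B := by
  -- densities
  set α' : (ι → Bool) → ℝ := fun t =>
    (univ.filter fun s => s ≤ t).sup' ⟨t, by simp⟩ fun s => mass μ (A ∩ F s) / mass μ (F s) with hα'
  set β' : (ι → Bool) → ℝ := fun t =>
    (univ.filter fun s => s ≤ t).sup' ⟨t, by simp⟩ fun s => mass μ (B ∩ F s) / mass μ (F s) with hβ'
  set γ₀ : (ι → Bool) → ℝ := fun t =>
    (univ.filter fun s => s ≤ t).sup' ⟨t, by simp⟩ fun s => mass μ (A ∩ B ∩ F s) / mass μ (F s) with hγ₀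
  set γ' : (ι → Bool) → ℝ := fun t => max (γ₀ t) (α' t * β' t) with hγ'
  have hAB : IsUpperSet ((A ∩ B : Finset α) : Set α) := by rw [Finset.coe_inter]; exact hA.inter hB
  have hαm : Monotone α' := env_mono μ F A
  have hβm : Monotone β' := env_mono μ F B
  have hγ₀m : Monotone γ₀ := env_mono μ F (A ∩ B)
  have hα0 : ∀ t, 0 ≤ α' t := fun t => env_nonneg hμ₀ F A t
  have hβ0 : ∀ t, 0 ≤ β' t := fun t => env_nonneg hμ₀ F B t
  -- mass identities `ν·density = fibre mass`
  have eA : ∀ t, ν t * α' t = mass μ (A ∩ F t) := fun t => by rw [hν]; exact mass_mul_env hμ₀ hμ hj hF hA t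
  have eB : ∀ t, ν t * β' t = mass μ (B ∩ F t) := fun t => by rw [hν]; exact mass_mul_env hμ₀ hμ hj hF hB t
  have eC : ∀ t, ν t * γ' t = mass μ (A ∩ B ∩ F t) := by
    intro t
    rw [hν]
    rcases (mass_nonneg hμ₀ (F t)).eq_or_lt with h0 | hpos
    · have hXt : mass μ (A ∩ B ∩ F t) = 0 :=
        le_antisymm (le_trans (mass_mono hμ₀ Finset.inter_subset_right) h0.symm.le) (mass_nonneg hμ₀ _)
      rw [← h0, hXt, zero_mul]
    · have e1 : γ₀ t = mass μ (A ∩ B ∩ F t) / mass μ (F t) := env_eq_dens hμ₀ hμ hj hF hAB hpos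
      have e2 : α' t = mass μ (A ∩ F t) / mass μ (F t) := env_eq_dens hμ₀ hμ hj hF hA hpos
      have e3 : β' t = mass μ (B ∩ F t) / mass μ (F t) := env_eq_dens hμ₀ hμ hj hF hB hpos
      have hle : α' t * β' t ≤ γ₀ t := by
        rw [e1, e2, e3]; exact dens_mul_dens_le hμ₀ hμ hj hF hA hB hpos
      show mass μ (F t) * max (γ₀ t) (α' t * β' t) = _
      rw [max_eq_left hle, e1, mul_div_cancel₀ _ hpos.ne']
  -- the pattern theorem
  have key := SahiE3SlotCertificate.phi_nonneg_of_certificate ν α' β' γ' T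
    (fun t => by rw [hν]; exact mass_nonneg hμ₀ _) (hα0 ⊥) hαm (hβ0 ⊥) hβm
    (fun t _ => max_le_max (hγ₀m bot_le) (mul_le_mul (hαm bot_le) (hβm bot_le) (hβ0 ⊥) (hα0 t)))
    (fun t _ => le_max_right _ _) hT0 hT1 hTsum hTi hTii
  -- translate sums of fibre data into masses
  have sν : ∑ t, ν t = mass μ univ := by
    rw [mass_eq_sum_fib μ hF univ]; exact Finset.sum_congr rfl fun t _ => by rw [hν, Finset.univ_inter]
  have sνU : ∑ t ∈ univ.erase ⊥, ν t = mass μ (univ.filter fun x => ∃ i, j i ≤ x) := by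
    rw [← Finset.inter_univ (univ.filter fun x => ∃ i, j i ≤ x), mass_hit_inter_eq μ hF univ]
    exact Finset.sum_congr rfl fun t _ => by rw [hν, Finset.univ_inter]
  have sA : ∑ t, ν t * α' t = mass μ A := by
    rw [mass_eq_sum_fib μ hF A]; exact Finset.sum_congr rfl fun t _ => eA t
  have sB : ∑ t, ν t * β' t = mass μ B := by
    rw [mass_eq_sum_fib μ hF B]; exact Finset.sum_congr rfl fun t _ => eB t
  have sC : ∑ t, ν t * γ' t = mass μ (A ∩ B) := by
    rw [mass_eq_sum_fib μ hF (A ∩ B)]; exact Finset.sum_congr rfl fun t _ => eC t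
  have sUA : ∑ t ∈ univ.erase ⊥, ν t * α' t = mass μ ((univ.filter fun x => ∃ i, j i ≤ x) ∩ A) := by
    rw [mass_hit_inter_eq μ hF A]; exact Finset.sum_congr rfl fun t _ => eA t
  have sUB : ∑ t ∈ univ.erase ⊥, ν t * β' t = mass μ ((univ.filter fun x => ∃ i, j i ≤ x) ∩ B) := by
    rw [mass_hit_inter_eq μ hF B]; exact Finset.sum_congr rfl fun t _ => eB t
  have sUC : ∑ t ∈ univ.erase ⊥, ν t * γ' t = mass μ ((univ.filter fun x => ∃ i, j i ≤ x) ∩ A ∩ B) := by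
    rw [Finset.inter_assoc, mass_hit_inter_eq μ hF (A ∩ B)]; exact Finset.sum_congr rfl fun t _ => eC t
  rw [sν, sνU, sA, sB, sC, sUA, sUB, sUC] at key
  unfold latticeE3
  linarith [key]

end Summit.CriticalPhenomena.PercolationContinuityZ3.Theorems.SahiE3HitSlotCertificate
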